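import Mathlib
import Summits.Ventures.PercRepro2.StarOMain
import Summits.Ventures.PercRepro2.StarBCert
import Summits.Ventures.PercRepro2.StarBAtoms
import Summits.Ventures.PercRepro2.StarBXhatB

/-!
# (HMF), hence (HCOV), when `a₃` is adjacent only to `a₁`, `a₂` and `b` — CLASS B (blind cell
PercRepro2, night-1 g9; NIGHT1-G8.md §2, §5, NIGHT1-G9.md §1–§2)

The masses of `HMFc` at the three-coin star `f₁ = {a₃,a₁}` (α), `f₂ = {a₃,a₂}` (β),
`f₃ = {a₃,b}` (s) are the expressions of StarBCert in the ten-cell table of the star-zeroed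
weights `pOut` (`HMFc_star_b`): the generic three-coin mass lemmas of the class-O chain
(StarOProb, StarOMassesA/BC) with the third vertex `b`, the event algebra of StarOEvAlgMain with
the roles of `o` and `b` exchanged, and the class-B mean field `Xhat_star_b` (StarBXhatB).
The table satisfies the six BHK / Harris slacks (`bhk_cross_gshare`, `bhk_same_gshare`,
`Eprod'_le`) and the two conditional-BHK atoms `m1`, `m2` (`StarBAtoms.m1_nonneg`,
`m2_nonneg` — BHK 1.4 with the avoided set `{a₂, b}`), so `StarB.form_nonneg` (the 21-coefficient
exact LP certificate j232819) gives `0 ≤ Z₁ · HMFc`; when `Z₁ = 0` every mass vanishes.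
Hence **`HMF_star_b`** and `HCov_star_b`: (HMF) for class B, unconditional, with `o` free (it may
coincide with a root or with `b`).
-/

namespace Summit.Ventures.PercRepro2

open StarGlue PendantRoot UnionCluster StarO

namespace StarB

section Main

variable {V : Type*} {E : Type*} [Fintype E] [DecidableEq E] [Fintype V] [DecidableEq V]
  {R : Type*} [Field R] [LinearOrder R] [IsStrictOrderedRing R]

variable (p : E → R) (ends : E → Sym2 V) {f₁ f₂ f₃ : E} {a₃ a₁ a₂ o b : V}

omit [Fintype V] [DecidableEq V] [LinearOrder R] [IsStrictOrderedRing R] in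
/-- The cell `c_ob` is symmetric in `o` and `b`. -/
lemma cobMass_swap (q : E → R) (o a₁ a₂ b : V) :
    cobMass q ends b a₁ a₂ o = cobMass q ends o a₁ a₂ b := by
  unfold cobMass
  congr 1
  ext ω
  simp only [Set.mem_inter_iff, Set.mem_compl_iff, mem_connEvent]
  constructor
  · rintro ⟨⟨⟨⟨⟨hQ, hb1⟩, hb2⟩, ho1⟩, ho2⟩, h⟩
    exact ⟨⟨⟨⟨⟨hQ, ho1⟩, ho2⟩, hb1⟩, hb2⟩, conn_symm h⟩
  · rintro ⟨⟨⟨⟨⟨hQ, ho1⟩, ho2⟩, hb1⟩, hb2⟩, h⟩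
    exact ⟨⟨⟨⟨⟨hQ, hb1⟩, hb2⟩, ho1⟩, ho2⟩, conn_symm h⟩

/-- **The masses of `HMFc` at the three-coin star of class B are the StarBCert expressions.** -/
theorem HMFc_star_b (hf₁ : ends f₁ = s(a₃, a₁)) (hf₂ : ends f₂ = s(a₃, a₂))
    (hf₃ : ends f₃ = s(a₃, b)) (hstar : ∀ e, a₃ ∈ ends e → e = f₁ ∨ e = f₂ ∨ e = f₃)
    (h31 : a₃ ≠ a₁) (h32 : a₃ ≠ a₂) (h3o : a₃ ≠ o) (h3b : a₃ ≠ b) (h12 : a₁ ≠ a₂) (h1b : a₁ ≠ b)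
    (h2b : a₂ ≠ b) :
    HMFc p ends o a₁ a₂ a₃ b =
      hmfcMass (prob (pOut p ends a₃) (avoidAll ends a₂ {a₁})) (prob (pOut p ends a₃) (avoidAll ends a₂ {a₁} ∩ connEvent ends a₁ b)) (prob (pOut p ends a₃) (avoidAll ends a₂ {a₁} ∩ connEvent ends a₂ b)) (prob (pOut p ends a₃) (avoidAll ends a₂ {a₁} ∩ connEvent ends a₂ b ∩ connEvent ends a₁ o)) (prob (pOut p ends a₃) (avoidAll ends a₂ {a₁} ∩ connEvent ends a₁ b ∩ connEvent ends a₁ o)) (prob (pOut p ends a₃) (avoidAll ends a₂ {a₁} ∩ connEvent ends a₁ b ∩ connEvent ends a₂ o)) (prob (pOut p ends a₃) (avoidAll ends a₂ {a₁} ∩ connEvent ends a₂ b ∩ connEvent ends a₂ o)) (prob (pOut p ends a₃) (avoidAll ends a₂ {a₁} ∩ (connEvent ends b a₁)ᶜ ∩ (connEvent ends b a₂)ᶜ ∩ connEvent ends a₁ o)) (prob (pOut p ends a₃) (avoidAll ends a₂ {a₁} ∩ (connEvent ends b a₁)ᶜ ∩ (connEvent ends b a₂)ᶜ ∩ connEvent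 ends a₂ o)) (cobMass (pOut p ends a₃) ends o a₁ a₂ b)
        (PocketConn.Eprod' (pOut p ends a₃) ends o a₁ a₂ b) (PocketConn.Eprod' (pOut p ends a₃) ends o a₂ a₁ b) (termW p ends o a₁ a₂ b {a₃}) (p f₁) (p f₂) (p f₃) := by
  obtain ⟨hf12, hf13, hf23⟩ := star_edges_ne ends hf₁ hf₂ hf₃ h12 h1b h2b h31 h32
  have hstar' : ∀ e, a₃ ∈ ends e → e = f₂ ∨ e = f₁ ∨ e = f₃ := fun e he => by
    rcases hstar e he with h | h | h
    · exact Or.inr (Or.inl h)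
    · exact Or.inl h
    · exact Or.inr (Or.inr h)
  have hcob' : cobMass (pOut p ends a₃) ends b a₁ a₂ o = cobMass (pOut p ends a₃) ends o a₁ a₂ b :=
    cobMass_swap ends (pOut p ends a₃) o a₁ a₂ b
  -- the masses: `Q`, `PD`
  have mQ := prob_Q_star p ends hf₁ hf₂ hf₃ hstar h31 h32 h3b hf12 hf13 hf23
  have mD := prob_PD_star p ends hf₁ hf₂ hf₃ hstar h31 h32 h3b hf12 hf13 hf23
  rw [prob_Q_oN (pOut p ends a₃) ends b a₁ a₂] at mD
  have mDoL := prob_PD_inter_conn_star p ends hf₁ hf₂ hf₃ hstar h31 h32 h3b hf12 hf13 hf23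
    (x := a₁) (y := o) h31.symm h3o.symm
  have mDoH := prob_PD_inter_conn_star p ends hf₁ hf₂ hf₃ hstar h31 h32 h3b hf12 hf13 hf23
    (x := a₂) (y := o) h32.symm h3o.symm
  have mM2 := prob_PD_inter_conn_star p ends hf₁ hf₂ hf₃ hstar h31 h32 h3b hf12 hf13 hf23
    (x := a₂) (y := b) h32.symm h3b.symm
  rw [prob_Q_oN_oH_zero (pOut p ends a₃) ends b a₁ a₂, mul_zero, add_zero] at mM2
  -- T masses
  have mT := prob_T_inter_conn_star p ends hf₁ hf₂ hf₃ hstar h31 h32 h3b hf12 hf13 hf23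
    (x := a₂) (y := a₂) h32.symm h32.symm
  rw [glue23_a2 ends b a₂ a₂, connEvent_self ends a₂, Set.univ_union, Set.inter_univ,
    Set.inter_univ, Set.inter_univ, Set.inter_univ, prob_Q_not_oL_univ (o := b) ends (pOut p ends a₃)] at mT
  have mTbH := prob_T_inter_conn_star p ends hf₁ hf₂ hf₃ hstar h31 h32 h3b hf12 hf13 hf23
    (x := a₂) (y := b) h32.symm h3b.symm
  rw [inter_conn_self, glue23_a2 ends b a₂ b, connEvent_self ends b, Set.union_univ,
    Set.inter_univ, prob_Q_not_oL_univ (o := b) ends (pOut p ends a₃)] at mTbH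
  have mTbL := prob_T_inter_conn_star p ends hf₁ hf₂ hf₃ hstar h31 h32 h3b hf12 hf13 hf23
    (x := a₁) (y := b) h31.symm h3b.symm
  rw [Q_oH_oL_empty (o := b) (a₁ := a₁) (a₂ := a₂) ends, prob_empty, mul_zero, add_zero,
    Q_glue23_a1 ends b a₁ a₂ b, prob_Q_not_oL (pOut p ends a₃) ends b a₁ a₂ (connEvent ends a₁ b),
    inter_conn_self, sub_self, mul_zero, add_zero] at mTbL
  have mToL := prob_T_inter_conn_star p ends hf₁ hf₂ hf₃ hstar h31 h32 h3b hf12 hf13 hf23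
    (x := a₁) (y := o) h31.symm h3o.symm
  rw [Q_glue23_a1 ends b a₁ a₂ o, prob_Q_not_oL (pOut p ends a₃) ends b a₁ a₂ (connEvent ends a₁ o)] at mToL
  have mToH := prob_T_inter_conn_star p ends hf₁ hf₂ hf₃ hstar h31 h32 h3b hf12 hf13 hf23
    (x := a₂) (y := o) h32.symm h3o.symm
  rw [glue23_a2 ends b a₂ o, prob_Q_not_oL_bH_union (pOut p ends a₃) ends b a₁ a₂ o, hcob'] at mToH
  -- T′ masses (roots swapped)
  have mTp := prob_T_inter_conn_star p ends (f₁ := f₂) (f₂ := f₁) (a₁ := a₂) (a₂ := a₁) hf₂ hf₁ hf₃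
    hstar' h32 h31 h3b hf12.symm hf23 hf13 (x := a₁) (y := a₁) h31.symm h31.symm
  rw [avoidAll_swap, glue23_eq_glue13, connEvent_comm ends b a₂, glue13_a1 ends b a₁ a₁,
    connEvent_self ends a₁, Set.univ_union, Set.inter_univ, Set.inter_univ, Set.inter_univ,
    Set.inter_univ, prob_Q_not_oH_univ (o := b) ends (pOut p ends a₃)] at mTp
  have mTpoL := prob_T_inter_conn_star p ends (f₁ := f₂) (f₂ := f₁) (a₁ := a₂) (a₂ := a₁) hf₂ hf₁ hf₃
    hstar' h32 h31 h3b hf12.symm hf23 hf13 (x := a₁) (y := o) h31.symm h3o.symm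
  rw [avoidAll_swap, glue23_eq_glue13, connEvent_comm ends b a₂, glue13_a1 ends b a₁ o,
    prob_Q_not_oH_bL_union (pOut p ends a₃) ends b a₁ a₂ o, hcob'] at mTpoL
  have mTpoH := prob_T_inter_conn_star p ends (f₁ := f₂) (f₂ := f₁) (a₁ := a₂) (a₂ := a₁) hf₂ hf₁ hf₃
    hstar' h32 h31 h3b hf12.symm hf23 hf13 (x := a₂) (y := o) h32.symm h3o.symm
  rw [avoidAll_swap, glue23_eq_glue13, connEvent_comm ends b a₂, Q_glue13_a2 ends b a₁ a₂ o,
    prob_Q_not_oH (pOut p ends a₃) ends b a₁ a₂ (connEvent ends a₂ o)] at mTpoH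
  -- Q masses with a connection
  have mQoL := prob_Q_inter_conn_star p ends hf₁ hf₂ hf₃ hstar h31 h32 h3b hf12 hf13 hf23
    (x := a₁) (y := o) h31.symm h3o.symm
  rw [glue13_a1 ends b a₁ o, prob_Q_not_oH_bL_union (pOut p ends a₃) ends b a₁ a₂ o, hcob',
    Q_glue23_a1 ends b a₁ a₂ o, prob_Q_not_oL (pOut p ends a₃) ends b a₁ a₂ (connEvent ends a₁ o)] at mQoL
  have mQoH := prob_Q_inter_conn_star p ends hf₁ hf₂ hf₃ hstar h31 h32 h3b hf12 hf13 hf23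
    (x := a₂) (y := o) h32.symm h3o.symm
  rw [Q_glue13_a2 ends b a₁ a₂ o, prob_Q_not_oH (pOut p ends a₃) ends b a₁ a₂ (connEvent ends a₂ o),
    glue23_a2 ends b a₂ o, prob_Q_not_oL_bH_union (pOut p ends a₃) ends b a₁ a₂ o, hcob'] at mQoH
  have mQbH := prob_Q_inter_conn_star p ends hf₁ hf₂ hf₃ hstar h31 h32 h3b hf12 hf13 hf23
    (x := a₂) (y := b) h32.symm h3b.symm
  rw [Q_glue13_a2 ends b a₁ a₂ b, prob_Q_not_oH (pOut p ends a₃) ends b a₁ a₂ (connEvent ends a₂ b),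
    inter_conn_self, sub_self, mul_zero, add_zero, glue23_a2 ends b a₂ b, connEvent_self ends b,
    Set.union_univ, Set.inter_univ, prob_Q_not_oL_univ (o := b) ends (pOut p ends a₃)] at mQbH
  have mQbL := prob_Q_inter_conn_star p ends hf₁ hf₂ hf₃ hstar h31 h32 h3b hf12 hf13 hf23
    (x := a₁) (y := b) h31.symm h3b.symm
  rw [glue13_a1 ends b a₁ b, connEvent_self ends b, Set.union_univ, Set.inter_univ,
    prob_Q_not_oH_univ (o := b) ends (pOut p ends a₃), Q_glue23_a1 ends b a₁ a₂ b,
    prob_Q_not_oL (pOut p ends a₃) ends b a₁ a₂ (connEvent ends a₁ b), inter_conn_self, sub_self, mul_zero,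
    add_zero] at mQbL
  -- the mean field
  have mX := Xhat_star_b p ends hf₁ hf₂ hf₃ hstar h31 h32 h3o h3b hf12 hf13 hf23
  have eN1 : avoidAll ends a₂ {a₁} ∩ (connEvent ends a₁ b)ᶜ ∩ connEvent ends a₁ o =
      avoidAll ends a₂ {a₁} ∩ (connEvent ends b a₁)ᶜ ∩ connEvent ends a₁ o := by
    rw [connEvent_comm ends a₁ b]
  rw [eN1, prob_Q_not_oL (pOut p ends a₃) ends b a₁ a₂ (connEvent ends a₁ o),
    prob_Q_not_oH (pOut p ends a₃) ends b a₁ a₂ (connEvent ends a₂ o)] at mX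
  have hheavy : heavySum ends (pOut p ends a₃) o a₁ a₂ b = prob (pOut p ends a₃) (avoidAll ends a₂ {a₁} ∩ connEvent ends a₂ b ∩ connEvent ends a₁ o) - PocketConn.Eprod' (pOut p ends a₃) ends o a₁ a₂ b := by
    unfold heavySum
    rw [PocketConn.sum_T_eq_expect (pOut p ends a₃) ends o a₁ a₂ b, PocketConn.expect_FT]
    congr 2
    ext ω
    simp only [Set.mem_inter_iff, mem_connEvent, Set.mem_compl_iff, avoidAll_eq_compl]
    constructor
    · rintro ⟨⟨h2b, h1o⟩, hQ⟩; exact ⟨⟨fun h => hQ (conn_symm h), h2b⟩, h1o⟩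
    · rintro ⟨⟨hQ, h2b⟩, h1o⟩; exact ⟨⟨h2b, h1o⟩, fun h => hQ (conn_symm h)⟩
  have hlight : lightSum ends (pOut p ends a₃) o a₁ a₂ b = prob (pOut p ends a₃) (avoidAll ends a₂ {a₁} ∩ connEvent ends a₁ b ∩ connEvent ends a₂ o) - PocketConn.Eprod' (pOut p ends a₃) ends o a₂ a₁ b := by
    unfold lightSum
    rw [PocketConn.sum_T_eq_expect (pOut p ends a₃) ends o a₂ a₁ b, PocketConn.expect_FT]
    congr 2
    ext ω
    simp only [Set.mem_inter_iff, mem_connEvent, Set.mem_compl_iff, avoidAll_eq_compl]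
    constructor
    · rintro ⟨⟨h1b, h2o⟩, hQ⟩; exact ⟨⟨hQ, h1b⟩, h2o⟩
    · rintro ⟨⟨hQ, h1b⟩, h2o⟩; exact ⟨⟨h1b, h2o⟩, hQ⟩
  -- the splits of `A_L`, `A_H`
  have sAL := prob_Q_split_o (o := b) (a₁ := a₁) (a₂ := a₂) ends (pOut p ends a₃) (connEvent ends a₁ o)
  have sAH := prob_Q_split_o (o := b) (a₁ := a₁) (a₂ := a₂) ends (pOut p ends a₃) (connEvent ends a₂ o)
  -- each mass is its StarBCert expression
  have eZ : prob p (avoidAll ends a₂ {a₁}) = ZMass (prob (pOut p ends a₃) (avoidAll ends a₂ {a₁})) (prob (pOut p ends a₃) (avoidAll ends a₂ {a₁} ∩ connEvent ends a₁ b)) (prob (pOut p ends a₃) (avoidAll ends a₂ {a₁} ∩ connEvent ends a₂ b)) (p f₁) (p f₂) (p f₃) := by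
    rw [mQ]; unfold ZMass; ring
  have eD : prob p (PDEvent ends a₁ a₂ a₃) = DMass (prob (pOut p ends a₃) (avoidAll ends a₂ {a₁})) (prob (pOut p ends a₃) (avoidAll ends a₂ {a₁} ∩ connEvent ends a₁ b)) (prob (pOut p ends a₃) (avoidAll ends a₂ {a₁} ∩ connEvent ends a₂ b)) (p f₁) (p f₂) (p f₃) := by
    rw [mD]; unfold DMass; ring
  have eDo : prob p (PDEvent ends a₁ a₂ a₃ ∩ connEvent ends a₁ o) + prob p (PDEvent ends a₁ a₂ a₃ ∩ connEvent ends a₂ o) =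
      DoMass (prob (pOut p ends a₃) (avoidAll ends a₂ {a₁} ∩ connEvent ends a₂ b ∩ connEvent ends a₁ o)) (prob (pOut p ends a₃) (avoidAll ends a₂ {a₁} ∩ connEvent ends a₁ b ∩ connEvent ends a₁ o)) (prob (pOut p ends a₃) (avoidAll ends a₂ {a₁} ∩ connEvent ends a₁ b ∩ connEvent ends a₂ o)) (prob (pOut p ends a₃) (avoidAll ends a₂ {a₁} ∩ connEvent ends a₂ b ∩ connEvent ends a₂ o)) (prob (pOut p ends a₃) (avoidAll ends a₂ {a₁} ∩ (connEvent ends b a₁)ᶜ ∩ (connEvent ends b a₂)ᶜ ∩ connEvent ends a₁ o)) (prob (pOut p ends a₃) (avoidAll ends a₂ {a₁} ∩ (connEvent ends b a₁)ᶜ ∩ (connEvent ends b a₂)ᶜ ∩ connEvent ends a₂ o)) (p f₁) (p f₂) (p f₃) := by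
    rw [mDoL, mDoH, sAL, sAH]; unfold DoMass; ring
  have eM2 : prob p (PDEvent ends a₁ a₂ a₃ ∩ connEvent ends a₂ b) = M2Mass (prob (pOut p ends a₃) (avoidAll ends a₂ {a₁} ∩ connEvent ends a₂ b)) (p f₁) (p f₂) (p f₃) := by
    rw [mM2]; unfold M2Mass; ring
  have eTbH : prob p (TEvent ends a₁ a₂ a₃ ∩ connEvent ends a₂ b) = PTbHMass (prob (pOut p ends a₃) (avoidAll ends a₂ {a₁})) (prob (pOut p ends a₃) (avoidAll ends a₂ {a₁} ∩ connEvent ends a₁ b)) (prob (pOut p ends a₃) (avoidAll ends a₂ {a₁} ∩ connEvent ends a₂ b)) (p f₁) (p f₂) (p f₃) := by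
    rw [mTbH]; unfold PTbHMass; ring
  have eTbL : prob p (TEvent ends a₁ a₂ a₃ ∩ connEvent ends a₁ b) = PTbLMass (prob (pOut p ends a₃) (avoidAll ends a₂ {a₁} ∩ connEvent ends a₁ b)) (p f₁) (p f₂) (p f₃) := by
    rw [mTbL]; unfold PTbLMass; ring
  have eT : prob p (TEvent ends a₁ a₂ a₃) = PTMass (prob (pOut p ends a₃) (avoidAll ends a₂ {a₁})) (prob (pOut p ends a₃) (avoidAll ends a₂ {a₁} ∩ connEvent ends a₁ b)) (prob (pOut p ends a₃) (avoidAll ends a₂ {a₁} ∩ connEvent ends a₂ b)) (p f₁) (p f₂) (p f₃) := by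
    rw [mT]; unfold PTMass; ring
  have eTp : prob p (TEvent ends a₂ a₁ a₃) = PTpMass (prob (pOut p ends a₃) (avoidAll ends a₂ {a₁})) (prob (pOut p ends a₃) (avoidAll ends a₂ {a₁} ∩ connEvent ends a₁ b)) (prob (pOut p ends a₃) (avoidAll ends a₂ {a₁} ∩ connEvent ends a₂ b)) (p f₁) (p f₂) (p f₃) := by
    rw [mTp]; unfold PTpMass; ring
  have eToU : prob p (TEvent ends a₁ a₂ a₃ ∩ connEvent ends a₁ o) + prob p (TEvent ends a₁ a₂ a₃ ∩ connEvent ends a₂ o) =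
      PToUMass (prob (pOut p ends a₃) (avoidAll ends a₂ {a₁} ∩ connEvent ends a₂ b ∩ connEvent ends a₁ o)) (prob (pOut p ends a₃) (avoidAll ends a₂ {a₁} ∩ connEvent ends a₁ b ∩ connEvent ends a₁ o)) (prob (pOut p ends a₃) (avoidAll ends a₂ {a₁} ∩ connEvent ends a₁ b ∩ connEvent ends a₂ o)) (prob (pOut p ends a₃) (avoidAll ends a₂ {a₁} ∩ connEvent ends a₂ b ∩ connEvent ends a₂ o)) (prob (pOut p ends a₃) (avoidAll ends a₂ {a₁} ∩ (connEvent ends b a₁)ᶜ ∩ (connEvent ends b a₂)ᶜ ∩ connEvent ends a₁ o)) (prob (pOut p ends a₃) (avoidAll ends a₂ {a₁} ∩ (connEvent ends b a₁)ᶜ ∩ (connEvent ends b a₂)ᶜ ∩ connEvent ends a₂ o)) (cobMass (pOut p ends a₃) ends o a₁ a₂ b) (p f₁) (p f₂) (p f₃) := by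
    rw [mToL, mToH, sAL, sAH]; unfold PToUMass; ring
  have eTpoU : prob p (TEvent ends a₂ a₁ a₃ ∩ connEvent ends a₁ o) + prob p (TEvent ends a₂ a₁ a₃ ∩ connEvent ends a₂ o) =
      PTpoUMass (prob (pOut p ends a₃) (avoidAll ends a₂ {a₁} ∩ connEvent ends a₂ b ∩ connEvent ends a₁ o)) (prob (pOut p ends a₃) (avoidAll ends a₂ {a₁} ∩ connEvent ends a₁ b ∩ connEvent ends a₁ o)) (prob (pOut p ends a₃) (avoidAll ends a₂ {a₁} ∩ connEvent ends a₁ b ∩ connEvent ends a₂ o)) (prob (pOut p ends a₃) (avoidAll ends a₂ {a₁} ∩ connEvent ends a₂ b ∩ connEvent ends a₂ o)) (prob (pOut p ends a₃) (avoidAll ends a₂ {a₁} ∩ (connEvent ends b a₁)ᶜ ∩ (connEvent ends b a₂)ᶜ ∩ connEvent ends a₁ o)) (prob (pOut p ends a₃) (avoidAll ends a₂ {a₁} ∩ (connEvent ends b a₁)ᶜ ∩ (connEvent ends b a₂)ᶜ ∩ connEvent ends a₂ o)) (cobMass (pOut p ends a₃) ends o a₁ a₂ b) (p f₁) (p f₂)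 (p f₃) := by
    rw [mTpoL, mTpoH, sAL, sAH]; unfold PTpoUMass; ring
  have eQoL : prob p (avoidAll ends a₂ {a₁} ∩ connEvent ends a₁ o) = QoLMass (prob (pOut p ends a₃) (avoidAll ends a₂ {a₁} ∩ connEvent ends a₂ b ∩ connEvent ends a₁ o)) (prob (pOut p ends a₃) (avoidAll ends a₂ {a₁} ∩ connEvent ends a₁ b ∩ connEvent ends a₁ o)) (prob (pOut p ends a₃) (avoidAll ends a₂ {a₁} ∩ (connEvent ends b a₁)ᶜ ∩ (connEvent ends b a₂)ᶜ ∩ connEvent ends a₁ o)) (cobMass (pOut p ends a₃) ends o a₁ a₂ b) (p f₁) (p f₂) (p f₃) := by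
    rw [mQoL, sAL]; unfold QoLMass; ring
  have eQoH : prob p (avoidAll ends a₂ {a₁} ∩ connEvent ends a₂ o) = QoHMass (prob (pOut p ends a₃) (avoidAll ends a₂ {a₁} ∩ connEvent ends a₁ b ∩ connEvent ends a₂ o)) (prob (pOut p ends a₃) (avoidAll ends a₂ {a₁} ∩ connEvent ends a₂ b ∩ connEvent ends a₂ o)) (prob (pOut p ends a₃) (avoidAll ends a₂ {a₁} ∩ (connEvent ends b a₁)ᶜ ∩ (connEvent ends b a₂)ᶜ ∩ connEvent ends a₂ o)) (cobMass (pOut p ends a₃) ends o a₁ a₂ b) (p f₁) (p f₂) (p f₃) := by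
    rw [mQoH, sAH]; unfold QoHMass; ring
  have eQbH : prob p (avoidAll ends a₂ {a₁} ∩ connEvent ends a₂ b) = QbHMass (prob (pOut p ends a₃) (avoidAll ends a₂ {a₁})) (prob (pOut p ends a₃) (avoidAll ends a₂ {a₁} ∩ connEvent ends a₁ b)) (prob (pOut p ends a₃) (avoidAll ends a₂ {a₁} ∩ connEvent ends a₂ b)) (p f₁) (p f₂) (p f₃) := by
    rw [mQbH]; unfold QbHMass; ring
  have eQbL : prob p (avoidAll ends a₂ {a₁} ∩ connEvent ends a₁ b) = QbLMass (prob (pOut p ends a₃) (avoidAll ends a₂ {a₁})) (prob (pOut p ends a₃) (avoidAll ends a₂ {a₁} ∩ connEvent ends a₁ b)) (prob (pOut p ends a₃) (avoidAll ends a₂ {a₁} ∩ connEvent ends a₂ b)) (p f₁) (p f₂) (p f₃) := by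
    rw [mQbL]; unfold QbLMass; ring
  have eX : Xhat p ends o a₁ a₂ a₃ b =
      XhatMass (prob (pOut p ends a₃) (avoidAll ends a₂ {a₁} ∩ connEvent ends a₂ b ∩ connEvent ends a₁ o)) (prob (pOut p ends a₃) (avoidAll ends a₂ {a₁} ∩ connEvent ends a₁ b ∩ connEvent ends a₂ o)) (prob (pOut p ends a₃) (avoidAll ends a₂ {a₁} ∩ (connEvent ends b a₁)ᶜ ∩ (connEvent ends b a₂)ᶜ ∩ connEvent ends a₁ o)) (prob (pOut p ends a₃) (avoidAll ends a₂ {a₁} ∩ (connEvent ends b a₁)ᶜ ∩ (connEvent ends b a₂)ᶜ ∩ connEvent ends a₂ o)) (PocketConn.Eprod' (pOut p ends a₃) ends o a₁ a₂ b) (PocketConn.Eprod' (pOut p ends a₃) ends o a₂ a₁ b) (termW p ends o a₁ a₂ b {a₃}) (p f₁) (p f₂) (p f₃) := by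
    rw [mX, hheavy, hlight, sAL, sAH]; unfold XhatMass; ring
  -- assemble
  have eT1 : connEvent ends a₂ b ∩ TEvent ends a₁ a₂ a₃ = TEvent ends a₁ a₂ a₃ ∩ connEvent ends a₂ b := Set.inter_comm _ _
  have eT2 : connEvent ends a₁ b ∩ TEvent ends a₁ a₂ a₃ = TEvent ends a₁ a₂ a₃ ∩ connEvent ends a₁ b := Set.inter_comm _ _
  have egap := PocketConn.gap_eq_on_Q p ends a₁ a₂ b
  rw [← avoidAll_eq_compl] at egap
  have eEQ3o : prob p (TEvent ends a₂ a₁ a₃ ∩ connEvent ends a₁ o) + prob p (TEvent ends a₂ a₁ a₃ ∩ connEvent ends a₂ o) -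
      prob p (TEvent ends a₁ a₂ a₃ ∩ connEvent ends a₁ o) - prob p (TEvent ends a₁ a₂ a₃ ∩ connEvent ends a₂ o) =
      (prob p (TEvent ends a₂ a₁ a₃ ∩ connEvent ends a₁ o) + prob p (TEvent ends a₂ a₁ a₃ ∩ connEvent ends a₂ o)) -
        (prob p (TEvent ends a₁ a₂ a₃ ∩ connEvent ends a₁ o) + prob p (TEvent ends a₁ a₂ a₃ ∩ connEvent ends a₂ o)) := by ring
  unfold HMFc CovForm.marginC CovForm.DEF CovForm.EQo CovForm.EQ3 CovForm.EQ3o CovForm.Do massM2 deltaT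
  rw [eT1, eT2, egap, eEQ3o, eDo, eToU, eTpoU, eZ, eD, eM2, eTbH, eTbL, eT, eTp, eQoL, eQoH, eQbH,
    eQbL, eX]
  unfold hmfcMass
  ring

/-- **(HMF) when `a₃` is adjacent only to `a₁`, `a₂` and `b`** — class B, unconditional (`o` free). -/
theorem HMF_star_b (hp : IsProbVec p) (hf₁ : ends f₁ = s(a₃, a₁)) (hf₂ : ends f₂ = s(a₃, a₂))
    (hf₃ : ends f₃ = s(a₃, b)) (hstar : ∀ e, a₃ ∈ ends e → e = f₁ ∨ e = f₂ ∨ e = f₃)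
    (h31 : a₃ ≠ a₁) (h32 : a₃ ≠ a₂) (h3o : a₃ ≠ o) (h3b : a₃ ≠ b) (h12 : a₁ ≠ a₂) (h1b : a₁ ≠ b)
    (h2b : a₂ ≠ b) : HMF p ends o a₁ a₂ a₃ b := by
  unfold HMF
  rw [HMFc_star_b p ends hf₁ hf₂ hf₃ hstar h31 h32 h3o h3b h12 h1b h2b]
  have hqp : IsProbVec (pOut p ends a₃) := PocketConn.IsProbVec.zeroOn hp _
  by_cases hZ : prob (pOut p ends a₃) (avoidAll ends a₂ {a₁}) = 0
  · -- every mass vanishes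
    have hle : ∀ X, prob (pOut p ends a₃) (avoidAll ends a₂ {a₁} ∩ X) = 0 := fun X =>
      le_antisymm (hZ ▸ prob_mono hqp Set.inter_subset_left) (prob_nonneg hqp _)
    have hcob : cobMass (pOut p ends a₃) ends o a₁ a₂ b = 0 := by
      unfold cobMass
      exact le_antisymm (hZ ▸ prob_mono hqp (by
        intro ω hω; exact hω.1.1.1.1.1)) (prob_nonneg hqp _)
    have hG : PocketConn.Eprod' (pOut p ends a₃) ends o a₁ a₂ b = 0 := by
      have h1 := PocketConn.Eprod'_le (pOut p ends a₃) ends hqp o a₁ a₂ b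
      have h2 : 0 ≤ PocketConn.Eprod' (pOut p ends a₃) ends o a₁ a₂ b := by
        unfold PocketConn.Eprod'
        refine expect_nonneg hqp fun ω => ?_
        refine mul_nonneg (mul_nonneg ?_ ?_) (Set.indicator_nonneg (fun _ _ => zero_le_one) _)
        · exact prob_nonneg hqp _
        · exact prob_nonneg hqp _
      have h3 : prob (pOut p ends a₃) (connEvent ends a₁ o ∩ connEvent ends a₁ b ∩ (connEvent ends a₂ a₁)ᶜ) = 0 := by
        refine le_antisymm (hZ ▸ prob_mono hqp ?_) (prob_nonneg hqp _)
        rintro ω ⟨_, hQ⟩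
        rw [avoidAll_eq_compl]
        exact fun h => hQ (conn_symm h)
      linarith
    have hG' : PocketConn.Eprod' (pOut p ends a₃) ends o a₂ a₁ b = 0 := by
      have h1 := PocketConn.Eprod'_le (pOut p ends a₃) ends hqp o a₂ a₁ b
      have h2 : 0 ≤ PocketConn.Eprod' (pOut p ends a₃) ends o a₂ a₁ b := by
        unfold PocketConn.Eprod'
        refine expect_nonneg hqp fun ω => ?_
        refine mul_nonneg (mul_nonneg ?_ ?_) (Set.indicator_nonneg (fun _ _ => zero_le_one) _)
        · exact prob_nonneg hqp _
        · exact prob_nonneg hqp _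
      have h3 : prob (pOut p ends a₃) (connEvent ends a₂ o ∩ connEvent ends a₂ b ∩ (connEvent ends a₁ a₂)ᶜ) = 0 := by
        refine le_antisymm (hZ ▸ prob_mono hqp ?_) (prob_nonneg hqp _)
        rintro ω ⟨_, hQ⟩
        rw [avoidAll_eq_compl]
        exact hQ
      linarith
    simp only [hle, hZ, hcob, hG, hG', hmfcMass, ZMass, DMass, DoMass, M2Mass, PTMass, PTpMass,
      PTbHMass, PTbLMass, PToUMass, PTpoUMass, QoLMass, QoHMass, QbHMass, QbLMass, XhatMass]
    ring_nf
    exact le_refl _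
  · have hZpos : 0 < prob (pOut p ends a₃) (avoidAll ends a₂ {a₁}) := lt_of_le_of_ne (prob_nonneg hqp _) (Ne.symm hZ)
    -- the events of the BHK / Harris lemmas in the table's form
    have eQ : (connEvent ends a₂ a₁)ᶜ = avoidAll ends a₂ {a₁} := by
      rw [avoidAll_eq_compl, connEvent_comm]
    have eQ' : (connEvent ends a₁ a₂)ᶜ = avoidAll ends a₂ {a₁} := (avoidAll_eq_compl _ _ _).symm
    have eXQ : ∀ X : Set (Config E), X ∩ avoidAll ends a₂ {a₁} = avoidAll ends a₂ {a₁} ∩ X := fun X => Set.inter_comm _ _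
    have eXYQ : ∀ X Y : Set (Config E), X ∩ Y ∩ avoidAll ends a₂ {a₁} = avoidAll ends a₂ {a₁} ∩ Y ∩ X := by
      intro X Y; ext ω; simp only [Set.mem_inter_iff]; tauto
    have eSw : ∀ X Y : Set (Config E), avoidAll ends a₂ {a₁} ∩ X ∩ Y = avoidAll ends a₂ {a₁} ∩ Y ∩ X := fun X Y =>
      Set.inter_right_comm _ _ _
    -- the splits of `A_L`, `A_H` and the `b`-marginal
    have sAL := prob_Q_split_o (o := b) (a₁ := a₁) (a₂ := a₂) ends (pOut p ends a₃) (connEvent ends a₁ o)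
    have sAH := prob_Q_split_o (o := b) (a₁ := a₁) (a₂ := a₂) ends (pOut p ends a₃) (connEvent ends a₂ o)
    have hBN : prob (pOut p ends a₃) (avoidAll ends a₂ {a₁} ∩ connEvent ends a₁ b) + prob (pOut p ends a₃) (avoidAll ends a₂ {a₁} ∩ connEvent ends a₂ b) ≤ prob (pOut p ends a₃) (avoidAll ends a₂ {a₁}) := by
      have h := prob_Q_split_o (o := b) (a₁ := a₁) (a₂ := a₂) ends (pOut p ends a₃) Set.univ
      simp only [Set.inter_univ] at h
      have := prob_nonneg hqp (avoidAll ends a₂ {a₁} ∩ (connEvent ends b a₁)ᶜ ∩ (connEvent ends b a₂)ᶜ)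
      linarith
    have hsLH : 0 ≤ prob (pOut p ends a₃) (avoidAll ends a₂ {a₁} ∩ connEvent ends a₁ o) * prob (pOut p ends a₃) (avoidAll ends a₂ {a₁} ∩ connEvent ends a₂ b) - prob (pOut p ends a₃) (avoidAll ends a₂ {a₁}) * prob (pOut p ends a₃) (avoidAll ends a₂ {a₁} ∩ connEvent ends a₂ b ∩ connEvent ends a₁ o) := by
      have h := PocketConn.bhk_cross_gshare (pOut p ends a₃) ends hqp o a₁ a₂ b
      rw [eQ, eXYQ, eXQ, eXQ, eSw] at h
      linarith
    have hsHL : 0 ≤ prob (pOut p ends a₃) (avoidAll ends a₂ {a₁} ∩ connEvent ends a₂ o) * prob (pOut p ends a₃) (avoidAll ends a₂ {a₁} ∩ connEvent ends a₁ b) - prob (pOut p ends a₃) (avoidAll ends a₂ {a₁}) * prob (pOut p ends a₃) (avoidAll ends a₂ {a₁} ∩ connEvent ends a₁ b ∩ connEvent ends a₂ o) := by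
      have h := PocketConn.bhk_cross_gshare (pOut p ends a₃) ends hqp o a₂ a₁ b
      rw [eQ', eXYQ, eXQ, eXQ, eSw] at h
      linarith
    have huLL : 0 ≤ prob (pOut p ends a₃) (avoidAll ends a₂ {a₁}) * PocketConn.Eprod' (pOut p ends a₃) ends o a₁ a₂ b - prob (pOut p ends a₃) (avoidAll ends a₂ {a₁} ∩ connEvent ends a₁ o) * prob (pOut p ends a₃) (avoidAll ends a₂ {a₁} ∩ connEvent ends a₁ b) := by
      have h := PocketConn.bhk_same_gshare (pOut p ends a₃) ends hqp o a₁ a₂ b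
      rw [eQ, eXQ, eXQ] at h
      linarith
    have huHH : 0 ≤ prob (pOut p ends a₃) (avoidAll ends a₂ {a₁}) * PocketConn.Eprod' (pOut p ends a₃) ends o a₂ a₁ b - prob (pOut p ends a₃) (avoidAll ends a₂ {a₁} ∩ connEvent ends a₂ o) * prob (pOut p ends a₃) (avoidAll ends a₂ {a₁} ∩ connEvent ends a₂ b) := by
      have h := PocketConn.bhk_same_gshare (pOut p ends a₃) ends hqp o a₂ a₁ b
      rw [eQ', eXQ, eXQ] at h
      linarith
    have hhLL : 0 ≤ prob (pOut p ends a₃) (avoidAll ends a₂ {a₁} ∩ connEvent ends a₁ b ∩ connEvent ends a₁ o) - PocketConn.Eprod' (pOut p ends a₃) ends o a₁ a₂ b := by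
      have h := PocketConn.Eprod'_le (pOut p ends a₃) ends hqp o a₁ a₂ b
      rw [eQ, eXYQ] at h
      linarith
    have hhHH : 0 ≤ prob (pOut p ends a₃) (avoidAll ends a₂ {a₁} ∩ connEvent ends a₂ b ∩ connEvent ends a₂ o) - PocketConn.Eprod' (pOut p ends a₃) ends o a₂ a₁ b := by
      have h := PocketConn.Eprod'_le (pOut p ends a₃) ends hqp o a₂ a₁ b
      rw [eQ', eXYQ] at h
      linarith
    -- the conditional-BHK atoms
    have eN : avoidAll ends a₂ {a₁} ∩ (connEvent ends a₁ b)ᶜ ∩ (connEvent ends a₂ b)ᶜ =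
        avoidAll ends a₂ {a₁} ∩ (connEvent ends b a₁)ᶜ ∩ (connEvent ends b a₂)ᶜ := by
      rw [connEvent_comm ends a₁ b, connEvent_comm ends a₂ b]
    have eBN : prob (pOut p ends a₃) (avoidAll ends a₂ {a₁} ∩ (connEvent ends b a₁)ᶜ ∩ (connEvent ends b a₂)ᶜ) =
        prob (pOut p ends a₃) (avoidAll ends a₂ {a₁}) - prob (pOut p ends a₃) (avoidAll ends a₂ {a₁} ∩ connEvent ends a₁ b) - prob (pOut p ends a₃) (avoidAll ends a₂ {a₁} ∩ connEvent ends a₂ b) := prob_Q_oN (pOut p ends a₃) ends b a₁ a₂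
    have eNL : avoidAll ends a₂ {a₁} ∩ connEvent ends a₁ o ∩ (connEvent ends a₁ b)ᶜ ∩ (connEvent ends a₂ b)ᶜ =
        avoidAll ends a₂ {a₁} ∩ (connEvent ends b a₁)ᶜ ∩ (connEvent ends b a₂)ᶜ ∩ connEvent ends a₁ o := by
      rw [connEvent_comm ends a₁ b, connEvent_comm ends a₂ b]
      ext ω; simp only [Set.mem_inter_iff]; tauto
    have eNH : avoidAll ends a₂ {a₁} ∩ connEvent ends a₂ o ∩ (connEvent ends a₁ b)ᶜ ∩ (connEvent ends a₂ b)ᶜ =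
        avoidAll ends a₂ {a₁} ∩ (connEvent ends b a₁)ᶜ ∩ (connEvent ends b a₂)ᶜ ∩ connEvent ends a₂ o := by
      rw [connEvent_comm ends a₁ b, connEvent_comm ends a₂ b]
      ext ω; simp only [Set.mem_inter_iff]; tauto
    have hm1 : 0 ≤ prob (pOut p ends a₃) (avoidAll ends a₂ {a₁} ∩ (connEvent ends b a₁)ᶜ ∩ (connEvent ends b a₂)ᶜ ∩ connEvent ends a₁ o) * prob (pOut p ends a₃) (avoidAll ends a₂ {a₁} ∩ connEvent ends a₂ b) - prob (pOut p ends a₃) (avoidAll ends a₂ {a₁} ∩ connEvent ends a₂ b ∩ connEvent ends a₁ o) * (prob (pOut p ends a₃) (avoidAll ends a₂ {a₁}) - prob (pOut p ends a₃) (avoidAll ends a₂ {a₁} ∩ connEvent ends a₁ b) - prob (pOut p ends a₃) (avoidAll ends a₂ {a₁} ∩ connEvent ends a₂ b)) := by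
      have h := m1_nonneg (pOut p ends a₃) ends hqp o a₁ a₂ b
      rw [eNL, eN, eBN, eSw _ (connEvent ends a₂ b)] at h
      exact h
    have hm2 : 0 ≤ prob (pOut p ends a₃) (avoidAll ends a₂ {a₁} ∩ (connEvent ends b a₁)ᶜ ∩ (connEvent ends b a₂)ᶜ ∩ connEvent ends a₂ o) * prob (pOut p ends a₃) (avoidAll ends a₂ {a₁} ∩ connEvent ends a₁ b) - prob (pOut p ends a₃) (avoidAll ends a₂ {a₁} ∩ connEvent ends a₁ b ∩ connEvent ends a₂ o) * (prob (pOut p ends a₃) (avoidAll ends a₂ {a₁}) - prob (pOut p ends a₃) (avoidAll ends a₂ {a₁} ∩ connEvent ends a₁ b) - prob (pOut p ends a₃) (avoidAll ends a₂ {a₁} ∩ connEvent ends a₂ b)) := by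
      have h := m2_nonneg (pOut p ends a₃) ends hqp o a₁ a₂ b
      rw [eNH, eN, eBN, eSw _ (connEvent ends a₁ b)] at h
      exact h
    have hX0 := termW_singleton_eq p ends h31 h32 h3o h3b hZ
    rw [sAL, sAH] at hX0
    rw [sAL] at hsLH huLL
    rw [sAH] at hsHL huHH
    have key := form_nonneg (R := R) (cob := cobMass (pOut p ends a₃) ends o a₁ a₂ b) hX0 (prob_nonneg hqp _) (prob_nonneg hqp _) (prob_nonneg hqp _)
      hBN hhLL hhHH hsLH hsHL huLL huHH hm1 hm2 (hp.nonneg f₁) (hp.le_one f₁) (hp.nonneg f₂)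
      (hp.le_one f₂) (hp.nonneg f₃) (hp.le_one f₃)
    exact (mul_nonneg_iff_of_pos_left hZpos).1 key

/-- **(HCOV) when `a₃` is adjacent only to `a₁`, `a₂` and `b`** — class B. -/
theorem HCov_star_b (hp : IsProbVec p) (hf₁ : ends f₁ = s(a₃, a₁)) (hf₂ : ends f₂ = s(a₃, a₂))
    (hf₃ : ends f₃ = s(a₃, b)) (hstar : ∀ e, a₃ ∈ ends e → e = f₁ ∨ e = f₂ ∨ e = f₃)
    (h31 : a₃ ≠ a₁) (h32 : a₃ ≠ a₂) (h3o : a₃ ≠ o) (h3b : a₃ ≠ b) (h12 : a₁ ≠ a₂) (h1b : a₁ ≠ b)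
    (h2b : a₂ ≠ b) : CovForm.HCov p ends o a₁ a₂ a₃ b :=
  HCov_of_HMF p hp ends o a₁ a₂ a₃ b (HMF_star_b p ends hp hf₁ hf₂ hf₃ hstar h31 h32 h3o h3b h12 h1b h2b)

end Main

end StarB

end Summit.Ventures.PercRepro2
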